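import Mathlib.AlgebraicGeometry.Morphisms.LocalFlatDescent
import Mathlib.AlgebraicGeometry.ZariskisMainTheorem
import Mathlib.RingTheory.Unramified.LocalStructure
import HarnessLib

/-!
# Finite étale morphisms descend along fpqc covers

Topic: `Literature/AlgebraicGeometry/Morphisms`. The properties "finite" and "étale" of a morphism
of schemes are local on the base for the fpqc topology (The Stacks Project, Lemma 02LA = 35.23.25
for "finite", Lemma 02VN = 35.23.31 for "étale"; SGA1 Exp. VIII–IX). In the form proved here:
for a cartesian square

```
P ──fst──▶ X
│          │
snd        f        `f` surjective, flat and quasi-compact (an fpqc cover),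
▼          ▼
Y ───g───▶ Z
```

if the base change `fst` of `g` is finite étale and `g` is separated, then `g` is finite étale
(`isFinite_and_etale_of_isPullback`). Étaleness, universal closedness and "locally of finite
type" descend by Mathlib's fpqc-descent instances (`Mathlib.AlgebraicGeometry.Morphisms.FlatDescent`,
`…LocalFlatDescent`); an étale morphism is locally quasi-finite; and a proper, locally quasi-finite
morphism is finite (Zariski's main theorem, Mathlib `IsFinite.of_isProper_of_locallyQuasiFinite`).
(Separatedness also descends — Stacks 02KU — but Mathlib does not yet have descent of closed
immersions, so it is kept as a hypothesis; in applications `g` is a base change of a separated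
morphism.) Typical use: `Z = X₀ ⊗_K L`, `X = X₀ ⊗_K Ω` for a field extension `Ω/L`, so that a finite
étale cover defined over `Ω` which is a base change from `L` is already finite étale over `L`.

Everything is proved from Mathlib; no definitions, no named facts.

## References

* The Stacks Project, Tag 02YJ (§ 35.23), Lemmas 02LA (finite) and 02VN (étale); Tag 02LS
  (finite = proper + locally quasi-finite). [StacksProject]
* A. Grothendieck, SGA 1, Exp. IX (descent of étale covers). [SGA1]
-/

universe u

open CategoryTheory CategoryTheory.Limits AlgebraicGeometry MorphismProperty

namespace Literature.AlgebraicGeometry.Morphisms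

/-- Étale morphisms are locally quasi-finite (affine-locally: an étale algebra is formally
unramified of finite type, hence quasi-finite — Mathlib instance in
`Mathlib.RingTheory.Unramified.LocalStructure`). Same statement and proof as
`Literature.AlgebraicGeometry.Motives.locallyQuasiFinite_of_etale` (kept private here to avoid
importing the abelian-variety files). [folklore] -/
private theorem locallyQuasiFinite_of_etale' {X Y : Scheme.{u}} (f : X ⟶ Y) [Etale f] :
    LocallyQuasiFinite f := by
  rw [HasRingHomProperty.iff_appLE (P := @LocallyQuasiFinite)]
  intro U V e
  have h : (f.appLE U V e).hom.Etale :=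
    HasRingHomProperty.appLE (P := @Etale) f inferInstance U V e
  algebraize [(f.appLE U V e).hom]
  change Algebra.QuasiFinite _ _
  have : Algebra.Etale Γ(Y, U) Γ(X, V) := h
  infer_instance

/-- **Étaleness descends along fpqc covers** (Stacks 02VN), cartesian-square form: if
`IsPullback fst snd f g` with `f` surjective, flat and quasi-compact and `fst` étale, then `g` is
étale. (A repackaging of Mathlib's `DescendsAlong @Etale (@Surjective ⊓ @Flat ⊓ @QuasiCompact)`.)
[cite: StacksProject, Tag 02VN] -/
theorem etale_of_isPullback {P X Y Z : Scheme.{u}} {fst : P ⟶ X} {snd : P ⟶ Y} {f : X ⟶ Z}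
    {g : Y ⟶ Z} (h : IsPullback fst snd f g) [Surjective f] [Flat f] [QuasiCompact f]
    [Etale fst] : Etale g :=
  MorphismProperty.of_isPullback_of_descendsAlong (P := @Etale)
    (Q := @Surjective ⊓ @Flat ⊓ @QuasiCompact) h ⟨⟨‹_›, ‹_›⟩, ‹_›⟩ ‹Etale fst›

/-- **Properness descends along fpqc covers for separated morphisms** (Stacks 02L1 for universal
closedness, 02KZ for finite type): if `IsPullback fst snd f g` with `f` surjective, flat and
quasi-compact, `fst` proper and `g` separated, then `g` is proper.
[cite: StacksProject, Tags 02L1 and 02KZ] -/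
theorem isProper_of_isPullback {P X Y Z : Scheme.{u}} {fst : P ⟶ X} {snd : P ⟶ Y} {f : X ⟶ Z}
    {g : Y ⟶ Z} (h : IsPullback fst snd f g) [Surjective f] [Flat f] [QuasiCompact f]
    [IsProper fst] [IsSeparated g] : IsProper g := by
  have hf : (@Surjective ⊓ @Flat ⊓ @QuasiCompact : MorphismProperty Scheme) f := ⟨⟨‹_›, ‹_›⟩, ‹_›⟩
  haveI : UniversallyClosed g :=
    MorphismProperty.of_isPullback_of_descendsAlong (P := @UniversallyClosed)
      (Q := @Surjective ⊓ @Flat ⊓ @QuasiCompact) h hf (inferInstance : UniversallyClosed fst)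
  haveI : LocallyOfFiniteType g :=
    MorphismProperty.of_isPullback_of_descendsAlong (P := @LocallyOfFiniteType)
      (Q := @Surjective ⊓ @Flat ⊓ @QuasiCompact) h hf (inferInstance : LocallyOfFiniteType fst)
  exact ⟨⟩

/-- **Finite étale morphisms descend along fpqc covers** (Stacks 02LA and 02VN; SGA1 IX), for a
separated `g`: if `IsPullback fst snd f g` with `f` surjective, flat and quasi-compact, `fst`
finite étale and `g` separated, then `g` is finite étale. Proof: `g` is étale and proper by
descent, étale ⇒ locally quasi-finite, and proper + locally quasi-finite ⇒ finite (Zariski's main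
theorem, Stacks 02LS). [cite: StacksProject, Tags 02LA and 02VN] -/
theorem isFinite_and_etale_of_isPullback {P X Y Z : Scheme.{u}} {fst : P ⟶ X} {snd : P ⟶ Y}
    {f : X ⟶ Z} {g : Y ⟶ Z} (h : IsPullback fst snd f g) [Surjective f] [Flat f]
    [QuasiCompact f] [IsFinite fst] [Etale fst] [IsSeparated g] : IsFinite g ∧ Etale g := by
  haveI : Etale g := etale_of_isPullback h
  haveI : IsProper g := isProper_of_isPullback h
  haveI : LocallyQuasiFinite g := locallyQuasiFinite_of_etale' g
  exact ⟨IsFinite.of_isProper_of_locallyQuasiFinite g, ‹Etale g›⟩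

/-- `pullback.snd` form of `isFinite_and_etale_of_isPullback`: if `g : Y → Z` is separated and
its base change `pullback.snd g f : Y ×_Z X → X` along some surjective flat quasi-compact
`f : X → Z` is finite étale, then `g` is finite étale. [cite: StacksProject, Tags 02LA and 02VN] -/
theorem isFinite_and_etale_of_pullback_snd {X Y Z : Scheme.{u}} (f : X ⟶ Z) (g : Y ⟶ Z)
    [Surjective f] [Flat f] [QuasiCompact f] [IsSeparated g]
    [IsFinite (pullback.snd g f)] [Etale (pullback.snd g f)] : IsFinite g ∧ Etale g :=
  isFinite_and_etale_of_isPullback (IsPullback.of_hasPullback g f).flip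

end Literature.AlgebraicGeometry.Morphisms
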